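import Summits.SmoothPoincare4.SmoothPoincare4.Theorems.ConvexBisectionAcyclicBisectionExistsTwistAmbientMap
import Summits.SmoothPoincare4.SmoothPoincare4.Theorems.ConvexBisectionAcyclicBisectionExistsPicardLefschetzNode
import Summits.SmoothPoincare4.SmoothPoincare4.Theorems.ConvexBisectionAcyclicBisectionExistsStabilisationCurves
import Summits.SmoothPoincare4.SmoothPoincare4.Theorems.ConvexBisectionAcyclicBisectionExistsPageRotationFlow
import HarnessLib

/-!
# The page Dehn twist along a charted curve of the page of direction `1` as a DIFFEOMORPHISM of
# `Base g`, and the twist package of its class (wave 6, brick G6-7 — third and last piece of (R-TWIST)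
# for node N3a `node_STcurve` of stub `stub_STgeo` = NF4 N3, line `modp-braid-orbits`, crux
# `ConvexBisection.AcyclicBisectionExists`, item stmt-SmoothPoincare4-10508; registered sub-goal
# `helper_twistPackage_of_chart`)

Input: a charted page curve `(a, φ)` of `page g 1` — the six clauses of node N1a (`φ : ℝ × ℝ → Base g`
smooth, `1`-periodic, core `a`, page-valued, injective on `[0,1) × (−1,1)`, positively oriented) — and a
sign `s`.  Output (`twistPackage_of_chart`, registered `helper_twistPackage_of_chart`): a **page Dehn twist
package** for the class `shadow g a` and sign `s` in the sense of `…StabilisationCurves.lean`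
(`stcurve_of_twists`): a continuous self-map `τ` of `Base g` preserving `page g 1`, carrying smoothly
embedded page curves to smoothly embedded curves, with
`shadow (τ ∘ K) = transvection (stdSymp ℤ g) (shadow a, s) (shadow K)` for every loop `K` of the page.

Construction: `τ` is the restriction to `Base g = {rho ≤ 1/4}` of the ambient twist `twistAmb`
(`…TwistAmbientMap.lean`, `helper_twistAmb_package`) built on the product chart of the ambient annulus
`Φ = Subtype.val ∘ φ` (`…TwistProductChart.lean`), with margin `ε = min (1/4) ((2 − M)/4)`,
`M = max ‖cx ∘ Φ‖ < 2` over `[0,1] × [−1,1]`, handedness `σ = ±1` and profile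
`β̂ r = smoothTransition (2r + 1/2)`; it is a diffeomorphism (inverse: handedness `−σ`; smoothness into the
regular domain by `HalfSliceAtlas.contMDiff_codRestrict`), so embeddings go to embeddings
(`twistPackage_of_diffeomorph`); on the page it is the shear `(u, r) ↦ (u ± β̂ r, r)` of the chart and
the identity off the annulus, so node N1a (`shadow_pageDehnTwist_eq_transvection`, applied to the
half-width sub-chart `φ' (u, r) = φ (u, r/2)` and `β = β̂ (·/2)`) computes the shadows.
Everything is proved; no definitions, no named facts, no `sorry`.  References: B. Farb, D. Margalit,
*A primer on mapping class groups* (2012), §3.1.1, Prop. 6.3 [FarbMargalit2012]. [folklore]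
-/

noncomputable section

set_option linter.dupNamespace false

open scoped Manifold ContDiff Topology
open Set Function Metric Complex Filter
open Literature.Topology.FourManifolds Literature.Topology.FourManifolds.LefschetzBase
  Literature.GroupTheory.CombinatorialGroupTheory.SignedHurwitz

namespace Summit.SmoothPoincare4.SmoothPoincare4.Theorems.AcyclicBisectionExists.ModpBraidOrbits

variable {g : ℕ} {φ : ℝ × ℝ → Base g} {a : Metric.sphere (0 : EuclideanSpace ℝ (Fin 2)) 1 → Base g}

/-! ## §1 The ambient annulus of a chart of the page of direction `1` -/

section Ambient

variable (hφs : ContMDiff 𝓘(ℝ, ℝ × ℝ) (𝓡∂ 4) ∞ φ) (hφ1 : ∀ u r, φ (u + 1, r) = φ (u, r))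
  (hφp : ∀ p, φ p ∈ page g 1) (hφi : InjOn φ (Ico (0 : ℝ) 1 ×ˢ Ioo (-1 : ℝ) 1))
  (hφo : ∀ u r, r ∈ Ioo (-1 : ℝ) 1 →
    0 < inner ℝ (deriv (fun r' => (φ (u, r')).1) r) (cplxJ (deriv (fun u' => (φ (u', r)).1) u)))

include hφp in
/-- The ambient annulus lies on `w = 1/2`. [folklore] -/
theorem w_val_chart (p : ℝ × ℝ) : w g (φ p).1 = 1 / 2 := (hφp p).2

include hφ1 hφi in
/-- Injectivity modulo `ℤ` of the ambient annulus. [folklore] -/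
theorem val_chart_eq_imp (p p' : ℝ × ℝ) (hp : p.2 ∈ Ioo (-1 : ℝ) 1) (hp' : p'.2 ∈ Ioo (-1 : ℝ) 1)
    (h : (φ p).1 = (φ p').1) : p.2 = p'.2 ∧ ∃ n : ℤ, p'.1 = p.1 + n :=
  chart_eq_iff hφ1 hφi hp hp' (Subtype.ext h)

include hφ1 hφp in
/-- **A bound `M < 2` of `‖cx‖` on the annulus** (compactness of `[0,1] × [−1,1]`, periodicity, and
`‖x‖² < 4` on the page). [folklore] -/
theorem exists_bound_cx (hφc : Continuous φ) :
    ∃ M : ℝ, M < 2 ∧ ∀ p : ℝ × ℝ, p.2 ∈ Ioo (-1 : ℝ) 1 → ‖cx (φ p).1‖ ≤ M := by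
  have hK : IsCompact (Icc (0 : ℝ) 1 ×ˢ Icc (-1 : ℝ) 1) := isCompact_Icc.prod isCompact_Icc
  have hf : Continuous fun p : ℝ × ℝ => ‖cx (φ p).1‖ :=
    (contDiff_cx.continuous.comp (continuous_subtype_val.comp hφc)).norm
  obtain ⟨p₀, -, hmax⟩ := hK.exists_isMaxOn ⟨(0, 0), ⟨⟨le_rfl, zero_le_one⟩, ⟨by norm_num, by norm_num⟩⟩⟩
    hf.continuousOn
  refine ⟨‖cx (φ p₀).1‖, ?_, fun p hp => ?_⟩
  · have h := (hφp p₀).1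
    exact lt_of_pow_lt_pow_left₀ 2 (by norm_num) (by nlinarith [norm_nonneg (cx (φ p₀).1)])
  · have hmem : (Int.fract p.1, p.2) ∈ Icc (0 : ℝ) 1 ×ˢ Icc (-1 : ℝ) 1 :=
      ⟨⟨Int.fract_nonneg _, (Int.fract_lt_one _).le⟩, ⟨hp.1.le, hp.2.le⟩⟩
    have h := hmax hmem
    simp only [mem_setOf_eq] at h
    have he : φ (Int.fract p.1, p.2) = φ p := by
      rw [Int.fract, show p.1 - (⌊p.1⌋ : ℝ) = p.1 + ((-⌊p.1⌋ : ℤ) : ℝ) by push_cast; ring,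
        periodic_int_of_periodic hφ1]
    rwa [he] at h

end Ambient

/-! ## §2 The half-width sub-chart and its six clauses -/

section Half

variable (hφs : ContMDiff 𝓘(ℝ, ℝ × ℝ) (𝓡∂ 4) ∞ φ) (hφ1 : ∀ u r, φ (u + 1, r) = φ (u, r))
  (hφa : ∀ u, φ (u, 0) = a (circlePt u)) (hφp : ∀ p, φ p ∈ page g 1)
  (hφi : InjOn φ (Ico (0 : ℝ) 1 ×ˢ Ioo (-1 : ℝ) 1))
  (hφo : ∀ u r, r ∈ Ioo (-1 : ℝ) 1 →
    0 < inner ℝ (deriv (fun r' => (φ (u, r')).1) r) (cplxJ (deriv (fun u' => (φ (u', r)).1) u)))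

include hφs in
/-- The half-width sub-chart is smooth. [folklore] -/
theorem contMDiff_halfChart : ContMDiff 𝓘(ℝ, ℝ × ℝ) (𝓡∂ 4) ∞ fun q : ℝ × ℝ => φ (q.1, q.2 / 2) :=
  hφs.comp (contDiff_fst.prodMk (contDiff_snd.div_const (2 : ℝ))).contMDiff

include hφi in
/-- The half-width sub-chart is injective on `[0,1) × (−1,1)`. [folklore] -/
theorem injOn_halfChart : InjOn (fun q : ℝ × ℝ => φ (q.1, q.2 / 2)) (Ico (0 : ℝ) 1 ×ˢ Ioo (-1 : ℝ) 1) := by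
  intro q hq q' hq' h
  have h1 : (q.1, q.2 / 2) ∈ Ico (0 : ℝ) 1 ×ˢ Ioo (-1 : ℝ) 1 :=
    ⟨hq.1, ⟨by linarith [hq.2.1], by linarith [hq.2.2]⟩⟩
  have h2 : (q'.1, q'.2 / 2) ∈ Ico (0 : ℝ) 1 ×ˢ Ioo (-1 : ℝ) 1 :=
    ⟨hq'.1, ⟨by linarith [hq'.2.1], by linarith [hq'.2.2]⟩⟩
  obtain ⟨h4, h5⟩ := Prod.mk.inj (hφi h1 h2 h)
  exact Prod.ext h4 (by linarith)

include hφs hφo in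
/-- The half-width sub-chart is positively oriented. [folklore] -/
theorem orient_halfChart (u r : ℝ) (hr : r ∈ Ioo (-1 : ℝ) 1) :
    0 < inner ℝ (deriv (fun r' => ((fun q : ℝ × ℝ => φ (q.1, q.2 / 2)) (u, r')).1) r)
      (cplxJ (deriv (fun u' => ((fun q : ℝ × ℝ => φ (q.1, q.2 / 2)) (u', r)).1) u)) := by
  have hr2 : r / 2 ∈ Ioo (-1 : ℝ) 1 := ⟨by linarith [hr.1], by linarith [hr.2]⟩
  have hd : deriv (fun r' : ℝ => r' / 2) r = 2⁻¹ := by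
    rw [deriv_div_const, deriv_id'']; norm_num
  have e1 : deriv (fun r' => ((fun q : ℝ × ℝ => φ (q.1, q.2 / 2)) (u, r')).1) r =
      (2 : ℝ)⁻¹ • deriv (fun r' => (φ (u, r')).1) (r / 2) := by
    show deriv ((fun r'' => (φ (u, r'')).1) ∘ fun r' : ℝ => r' / 2) r = _
    rw [deriv.scomp r (hasDerivAt_val_r hφs u (r / 2)).differentiableAt (differentiableAt_id.div_const _), hd]
  have e2 : deriv (fun u' => ((fun q : ℝ × ℝ => φ (q.1, q.2 / 2)) (u', r)).1) u =
      deriv (fun u' => (φ (u', r / 2)).1) u := rfl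
  rw [e1, e2, real_inner_smul_left]
  exact mul_pos (by norm_num) (hφo u (r / 2) hr2)

end Half

/-! ## §3 The twist package of a charted curve of the page of direction `1` -/

/-- The profile `β̂ r = smoothTransition (2r + 1/2)`: smooth, `0` below `−1/4`, `1` above `1/4`. [folklore] -/
theorem twistProfile_props : ContDiff ℝ ∞ (fun r : ℝ => Real.smoothTransition (2 * r + 1 / 2)) ∧
    (∀ r ≤ -(1 / 4 : ℝ), Real.smoothTransition (2 * r + 1 / 2) = 0) ∧
    (∀ r ≥ (1 / 4 : ℝ), Real.smoothTransition (2 * r + 1 / 2) = 1) :=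
  ⟨Real.smoothTransition.contDiff.comp ((contDiff_const.mul contDiff_id).add contDiff_const),
    fun r hr => Real.smoothTransition.zero_of_nonpos (by linarith),
    fun r hr => Real.smoothTransition.one_of_one_le (by linarith)⟩

/-- **The twist package of a charted curve of `page g 1`**: for every charted page curve `(a, φ)` of
the page of direction `1` (six clauses of node N1a) and sign `s` there is a continuous self-map `τ`
of `Base g` (a diffeomorphism: the page Dehn twist along `a`, right-handed iff `s`) preserving
`page g 1`, carrying smoothly embedded curves of the page to smoothly embedded curves, and acting on
shadows of page loops by `transvection (stdSymp ℤ g) (shadow a, s)`.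
[cite: FarbMargalit2012, Prop. 6.3] -/
theorem twistPackage_of_chart (g : ℕ) (s : Bool) (φ : ℝ × ℝ → Base g)
    (a : Metric.sphere (0 : EuclideanSpace ℝ (Fin 2)) 1 → Base g) (ha : Continuous a)
    (hφs : ContMDiff 𝓘(ℝ, ℝ × ℝ) (𝓡∂ 4) ∞ φ) (hφ1 : ∀ u r, φ (u + 1, r) = φ (u, r))
    (hφa : ∀ u, φ (u, 0) = a (circlePt u)) (hφp : ∀ p, φ p ∈ page g 1)
    (hφi : InjOn φ (Ico (0 : ℝ) 1 ×ˢ Ioo (-1 : ℝ) 1))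
    (hφo : ∀ u r, r ∈ Ioo (-1 : ℝ) 1 →
      0 < inner ℝ (deriv (fun r' => (φ (u, r')).1) r) (cplxJ (deriv (fun u' => (φ (u', r)).1) u))) :
    ∃ (τ : Base g → Base g) (hτ : Continuous τ), (∀ p ∈ page g 1, τ p ∈ page g 1) ∧
      (∀ K : Metric.sphere (0 : EuclideanSpace ℝ (Fin 2)) 1 → Base g,
        Manifold.IsSmoothEmbedding (𝓡 1) (𝓡∂ 4) ∞ K → (∀ θ, K θ ∈ page g 1) →
        Manifold.IsSmoothEmbedding (𝓡 1) (𝓡∂ 4) ∞ (τ ∘ K)) ∧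
      (∀ (K : Metric.sphere (0 : EuclideanSpace ℝ (Fin 2)) 1 → Base g) (hK : Continuous K),
        (∀ θ, K θ ∈ page g 1) →
        shadow g (τ ∘ K) (hτ.comp hK) = transvection (stdSymp ℤ g) (shadow g a ha, s) (shadow g K hK)) := by
  -- the ambient annulus and its data
  set Φ : ℝ × ℝ → EuclideanSpace ℝ (Fin 4) := fun p => (φ p).1 with hΦ
  have hΦs : ContDiff ℝ ∞ Φ := contDiff_val_of_chart hφs
  have hΦw : ∀ p, w g (Φ p) = 1 / 2 := w_val_chart hφp
  have hΦ1 : ∀ u r, Φ (u + 1, r) = Φ (u, r) := fun u r => by simp only [hΦ, hφ1]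
  have hΦi : ∀ p p' : ℝ × ℝ, p.2 ∈ Ioo (-1 : ℝ) 1 → p'.2 ∈ Ioo (-1 : ℝ) 1 → Φ p = Φ p' →
      p.2 = p'.2 ∧ ∃ n : ℤ, p'.1 = p.1 + n := val_chart_eq_imp hφ1 hφi
  have hΦd : ∀ p : ℝ × ℝ, p.2 ∈ Ioo (-1 : ℝ) 1 → Injective (fderiv ℝ Φ p) := fun p hp =>
    injective_fderiv_of_chart hφs hφo (u := p.1) hp
  obtain ⟨M, hM2, hM⟩ := exists_bound_cx hφ1 hφp hφs.continuous
  -- margin, handedness, profile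
  set ε : ℝ := min (1 / 4) ((2 - M) / 4) with hεdef
  have hε0 : 0 < ε := lt_min (by norm_num) (by linarith)
  have hε2 : ε < 1 / 2 := (min_le_left _ _).trans_lt (by norm_num)
  have hε : ε ≤ 1 / 2 := hε2.le
  have hM0 : 0 ≤ M := (norm_nonneg _).trans (hM (0, 0) ⟨by norm_num, by norm_num⟩)
  have hMε : (1 + ε) * M < 2 := by
    have h1 : ε ≤ (2 - M) / 4 := min_le_right _ _
    nlinarith
  set σ : ℝ := if s then 1 else -1 with hσdef
  have hσ : σ = 1 ∨ σ = -1 := by cases s <;> simp [hσdef]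
  set βh : ℝ → ℝ := fun r => Real.smoothTransition (2 * r + 1 / 2) with hβh
  obtain ⟨hβ, hβ0, hβ1⟩ := twistProfile_props
  obtain ⟨hsm, hrho, hinv1, hinv2, hon, hoff⟩ :=
    helper_twistAmb_package g Φ ε σ M βh hΦs hΦw hΦ1 hΦi hΦd hε0 hε2 hσ hβ hβ0 hβ1 hM hMε
  obtain ⟨hsm', hrho', -, -, hon', hoff'⟩ :=
    helper_twistAmb_package g Φ ε (-σ) M βh hΦs hΦw hΦ1 hΦi hΦd hε0 hε2
      (by rcases hσ with h | h <;> simp [h]) hβ hβ0 hβ1 hM hMε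
  -- the diffeomorphism of the base
  have hmem : ∀ x : Base g, rho g (twistAmb g Φ ε σ βh x.1) ≤ 1 / 4 := fun x => by rw [hrho]; exact x.2
  have hmem' : ∀ x : Base g, rho g (twistAmb g Φ ε (-σ) βh x.1) ≤ 1 / 4 := fun x => by rw [hrho']; exact x.2
  have h2 : ContMDiff (𝓡∂ 4) (𝓡 4) ∞ fun x : Base g => twistAmb g Φ ε σ βh x.1 := fun x =>
    (hsm x.1 x.2).contMDiffAt.comp x ((RegularSublevel.contMDiff_incl (isRegularLevel_rho g)) x)
  have h2' : ContMDiff (𝓡∂ 4) (𝓡 4) ∞ fun x : Base g => twistAmb g Φ ε (-σ) βh x.1 := fun x =>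
    (hsm' x.1 x.2).contMDiffAt.comp x ((RegularSublevel.contMDiff_incl (isRegularLevel_rho g)) x)
  have hcm : ContMDiff (𝓡∂ 4) (𝓡∂ 4) ∞ fun x : Base g =>
      RegularSublevel.mk (isRegularLevel_rho g) (twistAmb g Φ ε σ βh x.1) (hmem x) :=
    (RegularSublevel.halfSliceAtlas (isRegularLevel_rho g)).contMDiff_codRestrict hmem h2
  have hcm' : ContMDiff (𝓡∂ 4) (𝓡∂ 4) ∞ fun x : Base g =>
      RegularSublevel.mk (isRegularLevel_rho g) (twistAmb g Φ ε (-σ) βh x.1) (hmem' x) :=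
    (RegularSublevel.halfSliceAtlas (isRegularLevel_rho g)).contMDiff_codRestrict hmem' h2'
  let τD : Base g ≃ₘ^∞⟮𝓡∂ 4, 𝓡∂ 4⟯ Base g :=
    { toFun := fun x => RegularSublevel.mk (isRegularLevel_rho g) (twistAmb g Φ ε σ βh x.1) (hmem x)
      invFun := fun x => RegularSublevel.mk (isRegularLevel_rho g) (twistAmb g Φ ε (-σ) βh x.1) (hmem' x)
      left_inv := fun x => Subtype.ext (hinv1 x.1)
      right_inv := fun x => Subtype.ext (hinv2 x.1)
      contMDiff_toFun := hcm
      contMDiff_invFun := hcm' }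
  have hτD : ∀ x : Base g, (τD x).1 = twistAmb g Φ ε σ βh x.1 := fun x => rfl
  -- the chart point `(1/2, (u, r))` of the domain
  have hdom : ∀ u r : ℝ, r ∈ Ioo (-1 : ℝ) 1 → (((1 / 2 : ℂ)), (u, r)) ∈ twistDom ε := fun u r hr =>
    ⟨by rw [show (2 : ℂ) * (1 / 2) = 1 by norm_num, norm_one]; linarith, hr⟩
  have hformula : ∀ u r : ℝ, r ∈ Ioo (-1 : ℝ) 1 →
      twistAmb g Φ ε σ βh (Φ (u, r)) = Φ (u + σ * βh r, r) := fun u r hr => by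
    have h := hon _ (hdom u r hr)
    rw [prodChart_half] at h
    rw [h, show shearMap σ βh ((1 / 2 : ℂ), (u, r)) = ((1 / 2 : ℂ), (u + σ * βh r, r)) from rfl, prodChart_half]
  -- page preservation
  have hpage : ∀ p ∈ page g 1, τD p ∈ page g 1 := by
    intro p hp
    show RegularSublevel.mk (isRegularLevel_rho g) (twistAmb g Φ ε σ βh p.1) (hmem p) ∈ page g 1
    by_cases hO : p.1 ∈ prodChart g Φ '' twistDom ε
    · obtain ⟨q, hq, hqp⟩ := hO
      refine ⟨?_, ?_⟩
      · show ‖cx (twistAmb g Φ ε σ βh p.1)‖ ^ 2 < 4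
        rw [← hqp, hon q hq]
        have h := norm_cx_prodChart_lt (g := g) hε0.le hM hMε (shearMap_mem (σ := σ) (βh := βh) hq)
        nlinarith [norm_nonneg (cx (prodChart g Φ (shearMap σ βh q)))]
      · show w g (twistAmb g Φ ε σ βh p.1) = 1 / 2
        have hw : w g p.1 = 1 / 2 := hp.2
        rw [← hqp, hon q hq, w_prodChart hΦw]
        rw [← hqp, w_prodChart hΦw] at hw
        exact hw
    · have h : RegularSublevel.mk (isRegularLevel_rho g) (twistAmb g Φ ε σ βh p.1) (hmem p) = p :=
        Subtype.ext (hoff _ hO)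
      rw [h]; exact hp
  -- the N1a clauses for the half-width sub-chart
  have hτon : ∀ u r, r ∈ Ioo (-1 : ℝ) 1 → τD ((fun q : ℝ × ℝ => φ (q.1, q.2 / 2)) (u, r)) =
      (fun q : ℝ × ℝ => φ (q.1, q.2 / 2)) (u + (if s then βh (r / 2) else -βh (r / 2)), r) := by
    intro u r hr
    apply Subtype.ext
    rw [hτD]
    show twistAmb g Φ ε σ βh (Φ (u, r / 2)) = Φ (u + (if s then βh (r / 2) else -βh (r / 2)), r / 2)
    rw [hformula u (r / 2) ⟨by linarith [hr.1], by linarith [hr.2]⟩]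
    cases s <;> simp [hσdef]
  have hτoff : ∀ p ∈ page g 1, p ∉ (fun q : ℝ × ℝ => φ (q.1, q.2 / 2)) '' (univ ×ˢ Ioo (-1 : ℝ) 1) →
      τD p = p := by
    intro p hp hpn
    apply Subtype.ext
    rw [hτD]
    by_cases hO : p.1 ∈ prodChart g Φ '' twistDom ε
    · obtain ⟨q, hq, hqp⟩ := hO
      have hw1 : q.1 = 1 / 2 := by
        have hw : w g p.1 = 1 / 2 := hp.2
        rwa [← hqp, w_prodChart hΦw] at hw
      have hqp' : Φ q.2 = p.1 := by
        rw [← hqp, show q = ((1 / 2 : ℂ), q.2) from Prod.ext hw1 rfl, prodChart_half]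
      have hr := hq.2
      -- `|r| ≥ 1/2`, else `p` is a point of the half-width annulus
      have hbig : q.2.2 ≤ -(1 / 2) ∨ 1 / 2 ≤ q.2.2 := by
        by_contra hcon
        push Not at hcon
        refine hpn ⟨(q.2.1, 2 * q.2.2), ⟨mem_univ _, ⟨by linarith [hcon.1], by linarith [hcon.2]⟩⟩, ?_⟩
        apply Subtype.ext
        show Φ (q.2.1, 2 * q.2.2 / 2) = p.1
        rw [show 2 * q.2.2 / 2 = q.2.2 by ring]
        exact hqp'
      rw [← hqp', show q.2 = (q.2.1, q.2.2) from rfl, hformula q.2.1 q.2.2 hr]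
      rcases hbig with hle | hge
      · rw [show βh q.2.2 = 0 from hβ0 _ (by linarith), mul_zero, add_zero]
      · rw [show βh q.2.2 = 1 from hβ1 _ (by linarith), mul_one]
        rcases hσ with h1 | h1 <;> rw [h1]
        · rw [show q.2.1 + (1 : ℝ) = q.2.1 + ((1 : ℤ) : ℝ) by push_cast; ring, periodic_int_of_periodic hΦ1]
        · rw [show q.2.1 + (-1 : ℝ) = q.2.1 + ((-1 : ℤ) : ℝ) by push_cast; ring, periodic_int_of_periodic hΦ1]
    · exact hoff _ hO
  -- node N1a for the half-width sub-chart
  have hβ' : ContDiff ℝ ∞ fun r : ℝ => βh (r / 2) := hβ.comp (contDiff_id.div_const _)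
  have hsh : ∀ (K : Metric.sphere (0 : EuclideanSpace ℝ (Fin 2)) 1 → Base g) (hK : Continuous K),
      (∀ θ, K θ ∈ page g 1) →
      shadow g (τD ∘ K) (τD.continuous.comp hK) = transvection (stdSymp ℤ g) (shadow g a ha, s) (shadow g K hK) :=
    fun K hK hKc => shadow_pageDehnTwist_eq_transvection g (c := 1) norm_one τD τD.continuous ha s
      (fun q : ℝ × ℝ => φ (q.1, q.2 / 2)) (fun r => βh (r / 2)) (contMDiff_halfChart hφs)
      (fun u r => by show φ (u + 1, r / 2) = φ (u, r / 2); rw [hφ1])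
      (fun u => by show φ (u, 0 / 2) = a (circlePt u); rw [zero_div, hφa]) (fun q => hφp _)
      (injOn_halfChart hφi) (orient_halfChart hφs hφo) hβ'
      (fun r hr => hβ0 _ (by linarith)) (fun r hr => hβ1 _ (by linarith)) hτon hτoff hK hKc
  obtain ⟨τ, hτ, h1, h2, h3⟩ := twistPackage_of_diffeomorph g 1 (shadow g a ha) s τD hpage hsh
  exact ⟨τ, hτ, h1, h2, h3⟩

/-! ## The registered form -/

/-- **Sub-goal `helper_twistPackage_of_chart`** (G6-7, (R-TWIST) for node N3a `node_STcurve`): every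
charted page curve `(a, φ)` of the page of direction `1` (six clauses of node N1a) and sign `s` yield a
page Dehn twist package for the class `shadow g a` in the sense of `helper_STcurve_of_twists`.
[cite: FarbMargalit2012, Prop. 6.3] -/
theorem helper_twistPackage_of_chart : ∀ (g : ℕ) (s : Bool) (φ : ℝ × ℝ → Literature.Topology.FourManifolds.LefschetzBase.Base g) (a : Metric.sphere (0 : EuclideanSpace ℝ (Fin 2)) 1 → Literature.Topology.FourManifolds.LefschetzBase.Base g) (ha : Continuous a), ContMDiff 𝓘(ℝ, ℝ × ℝ) (𝓡∂ 4) ∞ φ → (∀ u r, φ (u + 1, r) = φ (u, r)) → (∀ u, φ (u, 0) = a (Literature.Topology.FourManifolds.circlePt u)) → (∀ p, φ p ∈ Literature.Topology.FourManifolds.LefschetzBase.page g 1) → Set.InjOn φ (Set.Ico (0 : ℝ) 1 ×ˢ Set.Ioo (-1 : ℝ) 1) → (∀ u r, r ∈ Set.Ioo (-1 : ℝ) 1 → 0 < inner ℝ (deriv (fun r' => (φ (u, r')).1) r) (Literature.Topology.FourManifolds.LefschetzBase.cplxJ (deriv (fun u' => (φ (u', r)).1) u))) → ∃ (τ : Literature.Topology.FourManifolds.LefschetzBase.Base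 g → Literature.Topology.FourManifolds.LefschetzBase.Base g) (hτ : Continuous τ), (∀ p ∈ Literature.Topology.FourManifolds.LefschetzBase.page g 1, τ p ∈ Literature.Topology.FourManifolds.LefschetzBase.page g 1) ∧ (∀ K : Metric.sphere (0 : EuclideanSpace ℝ (Fin 2)) 1 → Literature.Topology.FourManifolds.LefschetzBase.Base g, Manifold.IsSmoothEmbedding (𝓡 1) (𝓡∂ 4) ∞ K → (∀ θ, K θ ∈ Literature.Topology.FourManifolds.LefschetzBase.page g 1) → Manifold.IsSmoothEmbedding (𝓡 1) (𝓡∂ 4) ∞ (τ ∘ K)) ∧ (∀ (K : Metric.sphere (0 : EuclideanSpace ℝ (Fin 2)) 1 → Literature.Topology.FourManifolds.LefschetzBase.Base g) (hK : Continuous K), (∀ θ, K θ ∈ Literature.Topology.FourManifolds.LefschetzBase.page g 1) → Literature.Topology.FourManifolds.LefschetzBase.shadow g (τ ∘ K) (hτ.comp hK) = Literature.GroupTheory.CombinatorialGroupTheory.SignedHurwitz.transvection (Literature.GroupTheory.CombinatorialGroupTheory.SignedHurwitz.stdSymp ℤ g) (Literature.Topology.FourManifolds.LefschetzBase.shadow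 g a ha, s) (Literature.Topology.FourManifolds.LefschetzBase.shadow g K hK)) :=
  fun g s φ a ha hφs hφ1 hφa hφp hφi hφo => twistPackage_of_chart g s φ a ha hφs hφ1 hφa hφp hφi hφo

end Summit.SmoothPoincare4.SmoothPoincare4.Theorems.AcyclicBisectionExists.ModpBraidOrbits

end
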